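import Mathlib.Data.Nat.Choose.Sum
import Mathlib.Algebra.Order.BigOperators.Group.Finset
import Mathlib.Logic.Function.Iterate
import HarnessLib

/-!
# Hilbert functions as elements of `ℕ^ℕ`: iterated partial sums and the functions `Φ^{(t)}`
# (Cossart–Jannsen–Saito 2020, Def. 2.11–2.13)

Topic: `Literature/RingTheory/HilbertSamuel`. The order-theoretic layer underneath the
Hilbert–Samuel functions of Cossart–Jannsen–Saito's *Desingularization: Invariants and Strategy*
(LNM 2270), Ch. 2: the set `ℕ^ℕ` of functions `ν : ℕ → ℕ` with the PRODUCT ORDER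
"(2.1) `ν ≥ μ ⇔ ν(n) ≥ μ(n)` for any `n ∈ ℕ`" (this is Mathlib's order on `ℕ → ℕ`, `Pi.le_def`),
the operators `ν ↦ ν^{(t)}` of iterated partial sums, and the reference functions `Φ^{(t)}`:

* `psum ν` — `ν^{(1)}`, `ν^{(1)}(n) = Σ_{i=0}^{n} ν(i)`; `iterPSum t ν` — `ν^{(t)}`
  (Def. 2.11 for Hilbert functions, Rem. 2.12 (c) for arbitrary `ν ∈ ℕ^ℕ`:
  "`ν^{(t)}(n) = Σ_{i=0}^{n} ν^{(t-1)}(i)`").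
* `Phi` — `Φ = Φ^{(0)}`, `Φ(0) = 1`, `Φ(n) = 0` for `n > 0` (Def. 2.13), and
  `iterPSum_Phi_eq_choose` — "`Φ^{(t)}(n) = H^{(0)}(k[X_1, …, X_t])(n) = binom(n+t-1, n)`"
  (the binomial identity; with truncated subtraction the formula also covers `t = 0`).
* API [folklore]: unfolding lemmas, `iterPSum_add` (`(ν^{(s)})^{(t)} = ν^{(s+t)}`), monotonicity
  of `ν ↦ ν^{(t)}` for the product order (Rem. 2.29 (b): "`φ ≤ ψ ⟹ φ^{(1)} ≤ ψ^{(1)}`"),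
  `le_psum` and `psum_succ_sub` (the note after Def. 2.11:
  "`H^{(t-1)}(n) = H^{(t)}(n) - H^{(t)}(n-1) ≤ H^{(t)}(n)`"), injectivity of `ν ↦ ν^{(t)}`
  (Rem. 2.29 (b): "`φ = ψ ⟺ φ^{(m)} = ψ^{(m)}`"), monotonicity of `ν^{(t+1)}` in `n`.

The Hilbert(-Samuel) functions `H^{(t)}(A)`, `H^{(t)}_𝒪` of graded algebras and local rings
(Def. 2.11, §2.2 p. 27) are built on this in `LocalRing.lean`.

## Sources

* V. Cossart, U. Jannsen, S. Saito, *Desingularization: Invariants and Strategy — Application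
  to Dimension 2*, LNM 2270 (2020), Ch. 2: (2.1), Def. 2.11, Rem. 2.12, Def. 2.13, Rem. 2.29 (b).
  [CossartJannsenSaito2020]
-/

open Finset

namespace Literature.RingTheory.HilbertSamuel

/-! ## Iterated partial sums -/

/-- The partial-sum operator on `ℕ^ℕ`: `ν^{(1)}(n) = Σ_{i=0}^{n} ν(i)` (CJS Def. 2.11 /
Rem. 2.12 (c) with `t = 1`). [cite: CossartJannsenSaito2020, Rem. 2.12 (c)] -/
def psum (ν : ℕ → ℕ) (n : ℕ) : ℕ := ∑ i ∈ range (n + 1), ν i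

/-- The `t`-fold iterated partial sums `ν^{(t)}`: `ν^{(0)} = ν`,
`ν^{(t)}(n) = Σ_{i=0}^{n} ν^{(t-1)}(i)` (CJS Rem. 2.12 (c)). [cite: CossartJannsenSaito2020, Rem. 2.12 (c)] -/
def iterPSum (t : ℕ) (ν : ℕ → ℕ) : ℕ → ℕ := psum^[t] ν

/-- Unfolding. [folklore] -/
theorem psum_apply (ν : ℕ → ℕ) (n : ℕ) : psum ν n = ∑ i ∈ range (n + 1), ν i := rfl

/-- `ν^{(1)}(0) = ν(0)`. [folklore] -/
@[simp] theorem psum_zero (ν : ℕ → ℕ) : psum ν 0 = ν 0 := by simp [psum]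

/-- `ν^{(1)}(n+1) = ν^{(1)}(n) + ν(n+1)`. [folklore] -/
theorem psum_succ (ν : ℕ → ℕ) (n : ℕ) : psum ν (n + 1) = psum ν n + ν (n + 1) := by
  simp [psum, sum_range_succ _ (n + 1)]

/-- `ν^{(0)} = ν`. [folklore] -/
@[simp] theorem iterPSum_zero (ν : ℕ → ℕ) : iterPSum 0 ν = ν := rfl

/-- `ν^{(t+1)} = (ν^{(t)})^{(1)}`. [folklore] -/
theorem iterPSum_succ (t : ℕ) (ν : ℕ → ℕ) : iterPSum (t + 1) ν = psum (iterPSum t ν) :=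
  Function.iterate_succ_apply' psum t ν

/-- `ν^{(t+1)} = (ν^{(1)})^{(t)}`. [folklore] -/
theorem iterPSum_succ' (t : ℕ) (ν : ℕ → ℕ) : iterPSum (t + 1) ν = iterPSum t (psum ν) :=
  Function.iterate_succ_apply psum t ν

/-- `ν^{(1)} = iterPSum 1 ν`. [folklore] -/
@[simp] theorem iterPSum_one (ν : ℕ → ℕ) : iterPSum 1 ν = psum ν := rfl

/-- `(ν^{(t)})^{(s)} = ν^{(s+t)}` (CJS Rem. 2.29 (b): "`(φ^{(m_1)})^{(m_2)} = φ^{(m_1+m_2)}`").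
[cite: CossartJannsenSaito2020, Rem. 2.29 (b)] -/
theorem iterPSum_add (s t : ℕ) (ν : ℕ → ℕ) : iterPSum (s + t) ν = iterPSum s (iterPSum t ν) :=
  Function.iterate_add_apply psum s t ν

/-- The partial-sum operator is monotone for the product order (CJS Rem. 2.29 (b):
"`φ ≤ ψ ⟹ φ^{(1)} ≤ ψ^{(1)}`"). [cite: CossartJannsenSaito2020, Rem. 2.29 (b)] -/
theorem psum_mono : Monotone psum := fun _ _ h _ => sum_le_sum fun i _ => h i

/-- `ν ↦ ν^{(t)}` is monotone for the product order. [cite: CossartJannsenSaito2020, Rem. 2.29 (b)] -/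
theorem iterPSum_mono (t : ℕ) : Monotone (iterPSum t) := by
  induction t with
  | zero => exact fun _ _ h => h
  | succ t ih =>
    intro ν μ h
    rw [iterPSum_succ, iterPSum_succ]
    exact psum_mono (ih h)

/-- `ν ≤ ν^{(1)}` in the product order. [folklore] -/
theorem le_psum (ν : ℕ → ℕ) : ν ≤ psum ν := fun n =>
  single_le_sum (f := ν) (fun _ _ => Nat.zero_le _) (self_mem_range_succ n)

/-- `ν^{(t)} ≤ ν^{(t+1)}` in the product order (the note after CJS Def. 2.11:
"`H^{(t-1)}(A)(n) … ≤ H^{(t)}(n)`"). [cite: CossartJannsenSaito2020, Def. 2.11 (note)] -/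
theorem iterPSum_le_iterPSum_succ (t : ℕ) (ν : ℕ → ℕ) : iterPSum t ν ≤ iterPSum (t + 1) ν := by
  rw [iterPSum_succ]
  exact le_psum _

/-- `ν^{(1)}` is monotone in `n`. [folklore] -/
theorem monotone_psum (ν : ℕ → ℕ) : Monotone (psum ν) :=
  monotone_nat_of_le_succ fun n => by rw [psum_succ]; exact Nat.le_add_right _ _

/-- Recovering `ν` from `ν^{(1)}` (the note after CJS Def. 2.11:
"`H^{(t-1)}(A)(n) = H^{(t)}(A)(n) - H^{(t)}(A)(n-1)`"). [cite: CossartJannsenSaito2020, Def. 2.11 (note)] -/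
theorem psum_succ_sub (ν : ℕ → ℕ) (n : ℕ) : psum ν (n + 1) - psum ν n = ν (n + 1) := by
  rw [psum_succ, Nat.add_sub_cancel_left]

/-- `ν ↦ ν^{(1)}` is injective. [cite: CossartJannsenSaito2020, Rem. 2.29 (b)] -/
theorem psum_injective : Function.Injective psum := by
  intro ν μ h
  funext n
  cases n with
  | zero => rw [← psum_zero ν, ← psum_zero μ, h]
  | succ n => rw [← psum_succ_sub ν n, ← psum_succ_sub μ n, h]

/-- `ν ↦ ν^{(t)}` is injective (CJS Rem. 2.29 (b): "`φ = ψ ⟺ φ^{(m)} = ψ^{(m)}`").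
[cite: CossartJannsenSaito2020, Rem. 2.29 (b)] -/
theorem iterPSum_injective (t : ℕ) : Function.Injective (iterPSum t) :=
  Function.Injective.iterate psum_injective t

/-- Strict comparison is detected after partial sums: `ν ≤ μ` and `ν ≠ μ` force
`ν^{(t)} < μ^{(t)}`. [folklore] -/
theorem iterPSum_lt_iterPSum {ν μ : ℕ → ℕ} (t : ℕ) (h : ν < μ) : iterPSum t ν < iterPSum t μ :=
  lt_of_le_of_ne (iterPSum_mono t h.le) fun heq => h.ne (iterPSum_injective t heq)

/-! ## The functions `Φ^{(t)}` -/

/-- `Φ = Φ^{(0)} ∈ ℕ^ℕ`: `Φ(0) = 1`, `Φ(n) = 0` for `n > 0` (CJS Def. 2.13; the Hilbert function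
of a field). [cite: CossartJannsenSaito2020, Def. 2.13] -/
def Phi : ℕ → ℕ := fun n => if n = 0 then 1 else 0

/-- Unfolding. [folklore] -/
@[simp] theorem Phi_zero : Phi 0 = 1 := rfl

/-- Unfolding. [folklore] -/
theorem Phi_of_ne_zero {n : ℕ} (h : n ≠ 0) : Phi n = 0 := if_neg h

/-- Unfolding. [folklore] -/
@[simp] theorem Phi_succ (n : ℕ) : Phi (n + 1) = 0 := rfl

/-- `Φ^{(1)}` is the constant function `1`. [cite: CossartJannsenSaito2020, Def. 2.13] -/
@[simp] theorem psum_Phi (n : ℕ) : psum Phi n = 1 := by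
  induction n with
  | zero => simp
  | succ n ih => rw [psum_succ, ih, Phi_succ]

/-- **`Φ^{(t)}(n) = binom(n+t-1, n)`** (CJS Def. 2.13: "`Φ^{(t)}(n) = H^{(0)}(k[X_1,…,X_t])(n) =
binom(n+t-1, n)` for all `n ≥ 0`"; with truncated subtraction in `ℕ` the formula is also correct
for `t = 0`). Proof: the hockey-stick identity. [cite: CossartJannsenSaito2020, Def. 2.13] -/
theorem iterPSum_Phi_eq_choose : ∀ (t n : ℕ), iterPSum t Phi n = (n + t - 1).choose n
  | 0, 0 => by simp
  | 0, n + 1 => by simp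
  | 1, n => by simp
  | t + 2, n => by
    rw [iterPSum_succ, psum_apply]
    have ih : ∀ i, iterPSum (t + 1) Phi i = (i + t).choose t := fun i => by
      rw [iterPSum_Phi_eq_choose (t + 1) i, show i + (t + 1) - 1 = i + t by omega,
        Nat.choose_symm_add]
    simp_rw [ih, Nat.sum_range_add_choose n t, show n + (t + 2) - 1 = n + t + 1 by omega]
    rw [show n + t + 1 = n + (t + 1) by omega, Nat.choose_symm_add]

/-- The same in the symmetric form `Φ^{(t+1)}(n) = binom(n+t, t)`. [cite: CossartJannsenSaito2020, Def. 2.13] -/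
theorem iterPSum_succ_Phi_eq_choose (t n : ℕ) : iterPSum (t + 1) Phi n = (n + t).choose t := by
  rw [iterPSum_Phi_eq_choose, show n + (t + 1) - 1 = n + t by omega, Nat.choose_symm_add]

/-- `Φ^{(2)}(n) = n + 1`. [folklore] -/
theorem iterPSum_two_Phi (n : ℕ) : iterPSum 2 Phi n = n + 1 := by
  rw [iterPSum_succ_Phi_eq_choose]; simp

/-- The `Φ^{(t)}` increase with `t`: `Φ^{(t)} ≤ Φ^{(t+1)}`. [folklore] -/
theorem iterPSum_Phi_mono : Monotone fun t => iterPSum t Phi :=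
  monotone_nat_of_le_succ fun t => iterPSum_le_iterPSum_succ t Phi

/-- For `1 ≤ t` the function `Φ^{(t)}` takes the value `1` at `0` and is positive everywhere.
[folklore] -/
theorem iterPSum_Phi_pos {t : ℕ} (ht : 1 ≤ t) (n : ℕ) : 0 < iterPSum t Phi n := by
  obtain ⟨t, rfl⟩ := Nat.exists_eq_add_of_le' ht
  rw [iterPSum_succ_Phi_eq_choose]
  exact Nat.choose_pos (Nat.le_add_left t n)

end Literature.RingTheory.HilbertSamuel
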